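import Summits.RiemannHypothesis.RiemannHypothesis.Theorems.PfPersistenceGalerkinCutoffArch
import HarnessLib

/-!
# The Galerkin form of the cut-off profile in closed (Markov) form — GAL‑0 with the full bottom

`mechanism/rigidity campaign; no RH claims`.

For a window `win = (a, N)` and a coefficient vector `v`, with `f = cutoffProfile win v = 𝟙_{[-a,a]} · Σ vₙ ξₙ`
(even, real, `L²`, **not smooth**), PROVED here (RH-free):

* the POLAR IDENTITY `v ⬝ᵥ (polarBlock win · v) = weilPoleForm f = 2 (polarVec win ⬝ᵥ v)²`
  (`cosh(x/2)`-moments of the basis; the `sinh` moment vanishes by parity);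
* **THE CLOSED-FORM IDENTITY** `v ⬝ᵥ (zetaDatum win *ᵥ v) = weilPoleForm f + weilDirichletEnergy a f
  − weilMarkovConstant a · ∫ ‖f‖²` — the finite-section matrix form **is** the Markov closed form
  `P(f) + 𝓔_a(f) − M_a ‖f‖²` of the Weil quadratic form at the cut-off profile (polar + archimedean
  (`PfPersistenceGalerkinCutoffArch`) + prime (`PfPersistenceGalerkinCutoffProfile`) blocks);
* consequently, by the form-domain Markov bound `stub_formDomainPos` (PROVED, window-Lipschitz route), the
  **unconditional** Rayleigh–Ritz floor with the full bottom `weilGroundEnergy a · (v ⬝ᵥ v) ≤ v ⬝ᵥ (zetaDatum win *ᵥ v)`,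
  `weilGroundEnergy a ≤ bottomRayleigh (zetaDatum win)`, and `DetectablyNegative zetaDatum → ¬ RiemannHypothesis`
  with NO Galerkin hypothesis (compare the conditional versions in `PfPersistenceGalerkinFormDomain`).

About the typed target `GalerkinMatrixIdentity` (GAL‑0 (i)): its second conjunct is proved
(`galerkin_norm_identity`); by the closed-form identity its first conjunct `v ⬝ᵥ (ζ v) = (weilQuadratic f).re`
is **equivalent** to the Markov decomposition `(weilQuadratic f).re = P(f) + 𝓔_a(f) − M_a‖f‖²` **at the
non-smooth cut-off profiles** (`galerkinMatrixIdentity_iff_markov_at_cutoff`), which the tree proves only for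
smooth tests (`weilQuadratic_re_eq_weilPoleForm_add_weilDirichletEnergy_sub` needs `IsWeilTest`).  No
normalising constant appears (`c = 1`).  For the floor transfer the typed identity is not needed: the
closed form feeds `stub_formDomainPos` directly.
-/

set_option linter.dupNamespace false

noncomputable section

open Real intervalIntegral MeasureTheory Set Matrix Filter
open scoped Topology

namespace Summit.RiemannHypothesis.RiemannHypothesis.Theorems.PfPersistence

open Literature.NumberTheory.LFunctions

/-! ## 4. The polar block: `cosh`-moments of the basis and `weilPoleForm` of the cut-off profile -/

section Polar

open PolarRankOne

/-- `√(ρ(2a)/2) = sinh(a/2)/√a`. -/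
theorem sqrt_polarScale_div_two {a : ℝ} (ha : 0 < a) :
    Real.sqrt (polarScale (2 * a) / 2) = Real.sinh (a / 2) / Real.sqrt a := by
  have hcosh : Real.cosh a - 1 = 2 * Real.sinh (a / 2) ^ 2 := by
    have h1 := Real.cosh_two_mul (a / 2)
    have h2 := Real.cosh_sq (a / 2)
    rw [show 2 * (a / 2) = a by ring] at h1
    linarith
  rw [polarScale_two_mul, hcosh,
    show 2 * Real.sinh (a / 2) ^ 2 / a / 2 = Real.sinh (a / 2) ^ 2 / a by ring,
    Real.sqrt_div (sq_nonneg _), Real.sqrt_sq (Real.sinh_nonneg_iff.2 (by linarith))]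

/-- `∫_{-a}^{a} cosh(x/2) dx = 4 sinh(a/2)`. [folklore] -/
theorem integral_cosh_half (a : ℝ) :
    ∫ x in (-a)..a, Real.cosh (x / 2) = 4 * Real.sinh (a / 2) := by
  have hd : ∀ x ∈ Set.uIcc (-a) a,
      HasDerivAt (fun y : ℝ => 2 * Real.sinh (y / 2)) (Real.cosh (x / 2)) x := by
    intro x _
    have h : HasDerivAt (fun y : ℝ => 2 * Real.sinh (y / 2))
        (2 * (Real.cosh (x / 2) * (1 / 2))) x := ((hasDerivAt_half x).sinh).const_mul (2 : ℝ)
    exact h.congr_deriv (by ring)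
  rw [integral_eq_sub_of_hasDerivAt hd
    ((by fun_prop : Continuous fun y : ℝ => Real.cosh (y / 2)).intervalIntegrable _ _)]
  simp only [show -a / 2 = -(a / 2) by ring, Real.sinh_neg]
  ring

/-- The `cosh(x/2)`-moments of Connes' even basis on `[-a, a]` are the polar vector:
`∫_{-a}^{a} ξₙ(x) cosh(x/2) dx = √(ρ(2a)/2)·gₙ`. -/
theorem integral_xiEven_mul_cosh {a : ℝ} (ha : 0 < a) (n : ℕ) :
    ∫ x in (-a)..a, xiEven (2 * a) n x * Real.cosh (x / 2) =
      Real.sqrt (polarScale (2 * a) / 2) * polarGen (2 * a) n := by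
  rw [sqrt_polarScale_div_two ha]
  have hapos : 0 < Real.sqrt a := Real.sqrt_pos.2 ha
  have h2pos : 0 < Real.sqrt 2 := Real.sqrt_pos.2 (by norm_num)
  have hs2 : Real.sqrt 2 * Real.sqrt 2 = 2 := Real.mul_self_sqrt (by norm_num)
  by_cases hn : n = 0
  · subst hn
    simp only [xiEven_zero, polarGen, if_true, Nat.cast_zero]
    rw [intervalIntegral.integral_const_mul, integral_cosh_half,
      Real.sqrt_mul (by norm_num : (0:ℝ) ≤ 2) a]
    field_simp
    nlinarith [hs2]
  · set k : ℝ := 2 * π * n / (2 * a) with hk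
    have hxi : ∀ x, xiEven (2 * a) n x =
        (-1 : ℝ) ^ n * Real.sqrt (2 / (2 * a)) * Real.cos (k * x) := by
      intro x
      simp only [xiEven, hn, if_false, hk]
      congr 2
      field_simp
    simp_rw [hxi, mul_assoc]
    rw [intervalIntegral.integral_const_mul, intervalIntegral.integral_const_mul,
      integral_eq_sub_of_hasDerivAt (fun x _ => hasDerivAt_Fc k x)
        ((by fun_prop : Continuous fun y : ℝ => Real.cos (k * y) * Real.cosh (y / 2)).intervalIntegrable
          _ _)]
    have hka : k * a = n * π := by rw [hk]; field_simp
    have hsin : Real.sin (k * a) = 0 := by rw [hka]; exact Real.sin_nat_mul_pi n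
    have hcos : Real.cos (k * a) = (-1) ^ n := by rw [hka]; exact Real.cos_nat_mul_pi n
    have hsq : Real.sqrt (2 / (2 * a)) = 1 / Real.sqrt a := by
      rw [show (2 : ℝ) / (2 * a) = 1 / a by field_simp, Real.sqrt_div' 1 ha.le, Real.sqrt_one]
    have hD := (Dk_pos k).ne'
    have hF : Fc k a - Fc k (-a) = (-1 : ℝ) ^ n * Real.sinh (a / 2) / Dk k := by
      simp only [Fc]
      rw [show k * -a = -(k * a) by ring, Real.cos_neg, Real.sin_neg, hsin, hcos,
        show -a / 2 = -(a / 2) by ring, Real.sinh_neg, Real.cosh_neg]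
      field_simp
      ring
    rw [hF, hsq]
    simp only [polarGen, hn, if_false, ← hk]
    rcases neg_one_pow_eq_or ℝ n with h | h <;> rw [h] <;> field_simp

variable (win : Window) (v : Fin (win.N + 1) → ℝ)

/-- `∫_{-a}^{a} θ_v(x) cosh(x/2) dx = c ⬝ᵥ v` with the polar vector `c = polarVec win`. -/
theorem integral_profile_mul_cosh :
    ∫ x in (-win.a)..win.a, profile (2 * win.a) v x * Real.cosh (x / 2) = polarVec win ⬝ᵥ v := by
  have ha := win.ha
  have hint : ∀ x, profile (2 * win.a) v x * Real.cosh (x / 2) =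
      ∑ n : Fin (win.N + 1), v n * (xiEven (2 * win.a) n x * Real.cosh (x / 2)) := by
    intro x; unfold profile; rw [Finset.sum_mul]
    exact Finset.sum_congr rfl fun n _ => by ring
  simp_rw [hint]
  rw [intervalIntegral.integral_finsetSum (fun n _ => Continuous.intervalIntegrable (by fun_prop) _ _)]
  rw [dotProduct_comm]
  refine Finset.sum_congr rfl fun n _ => ?_
  rw [intervalIntegral.integral_const_mul, integral_xiEven_mul_cosh ha, polarVec]

/-- `∫_{-a}^{a} θ_v(x) sinh(x/2) dx = 0` (even profile against an odd weight). -/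
theorem integral_profile_mul_sinh :
    ∫ x in (-win.a)..win.a, profile (2 * win.a) v x * Real.sinh (x / 2) = 0 := by
  set g : ℝ → ℝ := fun x => profile (2 * win.a) v x * Real.sinh (x / 2) with hg
  have hodd : ∀ x, g (-x) = -g x := by
    intro x
    simp only [hg, CollarBound.profile_neg_arg, show -x / 2 = -(x / 2) by ring, Real.sinh_neg]
    ring
  have h1 : ∫ x in (-win.a)..win.a, g (-x) = ∫ x in (-win.a)..win.a, g x := by
    rw [intervalIntegral.integral_comp_neg]; simp
  have h2 : ∫ x in (-win.a)..win.a, g (-x) = -∫ x in (-win.a)..win.a, g x := by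
    simp_rw [hodd]; rw [intervalIntegral.integral_neg]
  show ∫ x in (-win.a)..win.a, g x = 0
  linarith

/-- The `cosh(t/2)`-moment of the cut-off profile is `polarVec win ⬝ᵥ v` (as a complex number). [folklore] -/
theorem integral_cutoff_mul_cosh :
    ∫ t, (Icc (-win.a) win.a).indicator (profile (2 * win.a) v) t * Real.cosh (t / 2) =
      polarVec win ⬝ᵥ v := by
  have ha := win.ha
  simp_rw [← Set.indicator_mul_left (Icc (-win.a) win.a)
    (profile (2 * win.a) v) (fun t => Real.cosh (t / 2))]
  rw [MeasureTheory.integral_indicator measurableSet_Icc, integral_Icc_eq_integral_Ioc,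
    ← intervalIntegral.integral_of_le (by linarith : -win.a ≤ win.a), integral_profile_mul_cosh]

/-- The `sinh(t/2)`-moment of the (even) cut-off profile vanishes. [folklore] -/
theorem integral_cutoff_mul_sinh :
    ∫ t, (Icc (-win.a) win.a).indicator (profile (2 * win.a) v) t * Real.sinh (t / 2) = 0 := by
  have ha := win.ha
  simp_rw [← Set.indicator_mul_left (Icc (-win.a) win.a)
    (profile (2 * win.a) v) (fun t => Real.sinh (t / 2))]
  rw [MeasureTheory.integral_indicator measurableSet_Icc, integral_Icc_eq_integral_Ioc,
    ← intervalIntegral.integral_of_le (by linarith : -win.a ≤ win.a), integral_profile_mul_sinh]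

/-- The pole form of the cut-off profile: `P(f) = 2 (c ⬝ᵥ v)²`. -/
theorem weilPoleForm_cutoffProfile :
    weilPoleForm (cutoffProfile win v) = 2 * (polarVec win ⬝ᵥ v) ^ 2 := by
  unfold weilPoleForm
  have h1 : ∫ t, cutoffProfile win v t * (Real.cosh (t / 2) : ℂ) = ((polarVec win ⬝ᵥ v : ℝ) : ℂ) := by
    rw [← integral_cutoff_mul_cosh win v, ← integral_complex_ofReal]
    congr 1; funext t; rw [cutoffProfile_apply]; push_cast; ring
  have h2 : ∫ t, cutoffProfile win v t * (Real.sinh (t / 2) : ℂ) = 0 := by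
    rw [show (0 : ℂ) = ((0 : ℝ) : ℂ) from Complex.ofReal_zero.symm, ← integral_cutoff_mul_sinh win v,
      ← integral_complex_ofReal]
    congr 1; funext t; rw [cutoffProfile_apply]; push_cast; ring
  rw [h1, h2, Complex.norm_real, Real.norm_eq_abs, sq_abs, norm_zero]
  ring

/-- The polar block form: `v ⬝ᵥ (polarBlock win · v) = 2 (c ⬝ᵥ v)² = P(f)`. -/
theorem polarBlock_form_eq :
    v ⬝ᵥ (polarBlock win *ᵥ v) = 2 * (polarVec win ⬝ᵥ v) ^ 2 := by
  have hmv : Matrix.vecMulVec (polarVec win) (polarVec win) *ᵥ v =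
      (polarVec win ⬝ᵥ v) • polarVec win := by
    ext i
    simp [Matrix.mulVec, Matrix.vecMulVec_apply, dotProduct, Finset.mul_sum, mul_comm, mul_left_comm]
  rw [polarBlock_eq_two_smul_vecMulVec, Matrix.smul_mulVec, hmv, dotProduct_smul,
    dotProduct_smul, smul_eq_mul, smul_eq_mul, dotProduct_comm v (polarVec win)]
  ring

/-- THE POLAR IDENTITY: `v ⬝ᵥ (polarBlock win · v) = weilPoleForm f`. [folklore] -/
theorem polarBlock_form_eq_weilPoleForm :
    v ⬝ᵥ (polarBlock win *ᵥ v) = weilPoleForm (cutoffProfile win v) := by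
  rw [polarBlock_form_eq, weilPoleForm_cutoffProfile]

end Polar

/-! ## 7. The closed-form identity and its consequences -/

section Assembly

variable (win : Window) (v : Fin (win.N + 1) → ℝ)

/-- **THE GALERKIN CLOSED-FORM IDENTITY (PROVED, RH-free).**  For every window `(a, N)` and every
coefficient vector `v`, the `ζ` even-block quadratic form is the Markov closed form of the cut-off profile
`f = 𝟙_{[-a,a]} Σ vₙ ξₙ`:
`v ⬝ᵥ (zetaDatum (a,N) · v) = P(f) + E_a(f) − M_a ‖f‖²`
(pole form + Dirichlet increment energy − Markov constant × mass; `weilPoleForm`, `weilDirichletEnergy`,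
`weilMarkovConstant` of `Literature/…/WeilMarkovQuadratic`).  This is the content of GAL-0 (i): for SMOOTH tests
the right-hand side is `Re Q` (`weilQuadratic_re_eq_weilPoleForm_add_weilDirichletEnergy_sub`); the cut-off
profile is only Lipschitz, and the identity holds for it in this closed (form-domain) shape. [folklore] -/
theorem galerkinForm_eq_closedForm :
    v ⬝ᵥ (zetaDatum win *ᵥ v) =
      weilPoleForm (cutoffProfile win v) + weilDirichletEnergy win.a (cutoffProfile win v) -
        weilMarkovConstant win.a * ∫ x, ‖cutoffProfile win v x‖ ^ 2 := by
  have hdec : zetaDatum win = polarBlock win - archBlock win - primesBlock zetaWeights win :=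
    evenBlock_eq_decomp zetaWeights win
  rw [hdec, Matrix.sub_mulVec, Matrix.sub_mulVec, dotProduct_sub, dotProduct_sub,
    integral_norm_sq_cutoffProfile, polarBlock_form_eq_weilPoleForm]
  have hA := archBlock_form_eq_energy win v
  have hP := primesBlock_form_eq_energy win v
  unfold weilDirichletEnergy weilMarkovConstant
  linear_combination hA + hP

/-- The second conjunct of `GalerkinMatrixIdentity`, unconditionally: `v ⬝ᵥ v = ‖f‖₂²`. -/
theorem galerkin_norm_identity : v ⬝ᵥ v = ∫ t, ‖cutoffProfile win v t‖ ^ 2 :=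
  (integral_norm_sq_cutoffProfile win v).symm

/-- **`GalerkinMatrixIdentity` DECODED (PROVED).**  Given the closed-form identity, the typed obligation
`GalerkinMatrixIdentity` (whose first conjunct is stated with `Re Q(f) = Re (weilQuadratic f)`, i.e. with the
DIGAMMA archimedean term evaluated at the non-smooth cut-off profile) is EQUIVALENT to the Markov / Bombieri
decomposition `Re Q(f) = P(f) + E_a(f) − M_a‖f‖²` AT THE CUT-OFF PROFILES — a statement about extending
`weilQuadratic_re_eq_weilPoleForm_add_weilDirichletEnergy_sub` from `IsWeilTest` to Lipschitz compactly supported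
`f` (true in the mathematics with normalising constant `c = 1`; not in the tree).  No other normalisation detail
separates the typed identity from the proved one. [folklore] -/
theorem galerkinMatrixIdentity_iff_markov_at_cutoff :
    GalerkinMatrixIdentity ↔ ∀ (win : Window) (v : Fin (win.N + 1) → ℝ),
      (weilQuadratic (cutoffProfile win v)).re =
        weilPoleForm (cutoffProfile win v) + weilDirichletEnergy win.a (cutoffProfile win v) -
          weilMarkovConstant win.a * ∫ x, ‖cutoffProfile win v x‖ ^ 2 := by
  constructor
  · intro h win v
    rw [← (h win v).1, galerkinForm_eq_closedForm]
  · intro h win v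
    exact ⟨by rw [h win v, galerkinForm_eq_closedForm], galerkin_norm_identity win v⟩

/-- **GAL-0 WITH THE FULL GROUND ENERGY (PROVED, RH-free, unconditional):**
`ε(a) · (v ⬝ᵥ v) ≤ v ⬝ᵥ (zetaDatum (a,N) · v)` — the continuum Weil ground energy at half-length `a` is a
floor for every Galerkin Rayleigh quotient of `ζ`'s even block at `(a, N)`.  Closed-form identity + the
form-domain Markov bound `stub_formDomainPos` (the cut-off profile is in the form domain:
`memLp_cutoffProfile`, `integrableOn_archEnergy_cutoffProfile`). [folklore] -/
theorem weilGroundEnergy_mul_le_galerkinForm :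
    weilGroundEnergy win.a * (v ⬝ᵥ v) ≤ v ⬝ᵥ (zetaDatum win *ᵥ v) := by
  have h := Summit.RiemannHypothesis.RiemannHypothesis.Theorems.WeilWindowFlowWindowLipschitz.stub_formDomainPos
    win.a win.ha (cutoffProfile win v) (memLp_cutoffProfile win v)
    (ae_of_all _ fun x hx => cutoffProfile_eq_zero_of_not_mem win v hx)
    (integrableOn_archEnergy_cutoffProfile win v)
  rw [galerkinForm_eq_closedForm, integral_norm_sq_cutoffProfile]
  rw [integral_norm_sq_cutoffProfile] at h
  linarith

/-- **PROVED (RH-free, unconditional): `ε(a) ≤ bottomRayleigh (ζ-block at (a, N))`** — GAL-0 in the served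
`bottomRayleigh` form with the full ground energy (compare `weilEvenGroundEnergy_le_bottomRayleigh`, which is
conditional on `GalerkinRayleighRitz`). [folklore] -/
theorem weilGroundEnergy_le_bottomRayleigh (win : Window) :
    weilGroundEnergy win.a ≤ bottomRayleigh (zetaDatum win) := by
  have hne : ({r : ℝ | ∃ v : Fin (win.N + 1) → ℝ, v ≠ 0 ∧
      r = v ⬝ᵥ (zetaDatum win *ᵥ v) / (v ⬝ᵥ v)}).Nonempty := by
    refine ⟨_, fun _ ↦ 1, ?_, rfl⟩
    intro h
    exact one_ne_zero (congr_fun h 0)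
  refine le_csInf hne ?_
  rintro r ⟨v, hv, rfl⟩
  rw [le_div_iff₀ (dotProduct_self_pos_of_ne_zero hv)]
  exact weilGroundEnergy_mul_le_galerkinForm win v

/-- **PROVED (RH-free, unconditional):** a negative Galerkin Rayleigh quotient of `ζ`'s even block at `(a, N)`
forces `ε(a) < 0`. [folklore] -/
theorem weilGroundEnergy_neg_of_form_neg (hneg : v ⬝ᵥ (zetaDatum win *ᵥ v) < 0) :
    weilGroundEnergy win.a < 0 := by
  have hv : v ≠ 0 := by
    rintro rfl
    simp at hneg
  have hvv := dotProduct_self_pos_of_ne_zero hv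
  have h := weilGroundEnergy_mul_le_galerkinForm win v
  by_contra hE
  push Not at hE
  have := mul_nonneg hE hvv.le
  linarith

/-- **PROVED (RH-free, unconditional): a detectably negative `ζ`-window refutes RH** — no `GalerkinRayleighRitz`
hypothesis (compare `not_riemannHypothesis_of_detectablyNegative`).  `ε(a) < 0` contradicts Weil positivity on
`K_a` (`weilGroundEnergy_nonneg_iff_holds`), which RH implies (`weil_criterion_holds`). [folklore] -/
theorem not_riemannHypothesis_of_detectablyNegative' (h : DetectablyNegative zetaDatum) :
    ¬ RiemannHypothesis := by
  obtain ⟨win, v, hneg⟩ := h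
  have hE := weilGroundEnergy_neg_of_form_neg win v hneg
  intro hRH
  have hW : WeilPositivity := weil_criterion_holds.1 hRH
  have : 0 ≤ weilGroundEnergy win.a :=
    (weilGroundEnergy_nonneg_iff_holds win.ha).2 fun g hg _ => hW g hg
  linarith

/-- For the record: the typed GAL-0 (`GalerkinRayleighRitz`, stated with the EVEN ground energy `ε_ev ≥ ε`)
implies the full-ground-energy floor proved here (`weilGroundEnergy_le_weilEvenGroundEnergy`); the converse
upgrade `ε ↦ ε_ev` needs the even-sector form-domain bound (not in the tree). [folklore] -/
theorem weilGroundEnergy_mul_le_of_galerkinRayleighRitz (hG : GalerkinRayleighRitz)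
    (win : Window) (v : Fin (win.N + 1) → ℝ) :
    weilGroundEnergy win.a * (v ⬝ᵥ v) ≤ v ⬝ᵥ (zetaDatum win *ᵥ v) := by
  have h1 := hG win v
  have h2 := weilGroundEnergy_le_weilEvenGroundEnergy win.a
  have hvv : 0 ≤ v ⬝ᵥ v := by
    rw [galerkin_norm_identity win v]; positivity
  nlinarith

end Assembly

end Summit.RiemannHypothesis.RiemannHypothesis.Theorems.PfPersistence
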